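import Summits.Parity.GeneralizedHardyLittlewood.Theorems.Dhl42Staircase

/-!
# DHL[42,2] certificate — Lemma 4.5 (the bridge to (H2) of Proposition 4.4), arithmetic form

§1 refinements (mass, non-negativity, additivity); §2 the logarithmic multiset of a squarefree
number (mass, products, sub-multisets, `logBlocks`); §3 the heart of Lemma 4.5 at the level of
multisets (`condC_of_pc`: the pair condition at a corner forces `𝒞_{i_g}(c_g; ·)` for the joined
logarithmic multisets); §4 **Lemma 4.5**: for a `ϱ`-admissible pair, moduli built at corners of
`(Ω^{+ϱ}, Ω'^{+ϱ})` are `i_g`-tuply densely divisible (`denselyDivisible_of_pc`,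
`denselyDivisible_of_admissible(')`). NOT here: the Section-7 instance (→ `Dhl42BridgeH2Instance`).

Origin: `Dhl42/BridgeH2.lean` of the DHL[42,2] certificate package (pub-dhl42 bundle, archive blob
`18cce9e3`; sha256[:16] of the file `d683540e473e658e`; paper snapshot = `paper/main.tex` v1), lines
:46–:312; statements and proofs unchanged except: namespace `TpY4Dhl42` →
`Summit.Parity.GeneralizedHardyLittlewood.Theorems.Dhl42`, the package's `simplexSet n B` replaced
by the tree's definitionally equal `Literature.NumberTheory.Sieve.scaledSimplex n B` (also inside
declaration names), docstrings added where missing, `#print axioms` lines dropped. Package-internal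
references in the verbatim docstrings (`Dhl42/….lean`, `Assumed.…`, `row 9…`, `gen n`,
`inputs/COMPARE.md`) refer to that package (paper Appendix B).

Declarations (12): `IsRefinement.sum_eq`, `IsRefinement.nonneg`, `IsRefinement.add`,
`logMultiset_sum_of_squarefree`, `logMultiset_mul_of_coprime`, `logMultiset_le_of_forall_mem`,
`isRefinement_logBlocks`, `mem_join_logBlocks`, `condC_of_pc`, `denselyDivisible_of_pc`,
`denselyDivisible_of_admissible`, `denselyDivisible_of_admissible'`.
-/

open Finset
open Literature.NumberTheory.Sieve (DenselyDivisible)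

namespace Summit.Parity.GeneralizedHardyLittlewood.Theorems.Dhl42

/-! ### §1. Refinements: two bookkeeping facts and additivity -/

/-- A refinement has the same total mass. -/
theorem IsRefinement.sum_eq {V' V : Multiset ℝ} (h : IsRefinement V' V) : V'.sum = V.sum := by
  obtain ⟨P, -, rfl, rfl⟩ := h
  exact Multiset.sum_join

/-- A refinement consists of non-negative reals (the blocks do). -/
theorem IsRefinement.nonneg {V' V : Multiset ℝ} (h : IsRefinement V' V) : ∀ x ∈ V', 0 ≤ x := by
  obtain ⟨P, hP, -, rfl⟩ := h
  intro x hx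
  obtain ⟨W, hW, hxW⟩ := Multiset.mem_join.1 hx
  exact hP W hW x hxW

/-- Refinements add. -/
theorem IsRefinement.add {V₁' V₁ V₂' V₂ : Multiset ℝ} (h₁ : IsRefinement V₁' V₁)
    (h₂ : IsRefinement V₂' V₂) : IsRefinement (V₁' + V₂') (V₁ + V₂) := by
  obtain ⟨P₁, hP₁, rfl, rfl⟩ := h₁
  obtain ⟨P₂, hP₂, rfl, rfl⟩ := h₂
  refine ⟨P₁ + P₂, fun W hW => ?_, by rw [Multiset.map_add], by rw [Multiset.join_add]⟩
  rcases Multiset.mem_add.1 hW with h | h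
  exacts [hP₁ W h, hP₂ W h]

/-! ### §2. The logarithmic multiset of a squarefree number: mass, products, sub-multisets -/

/-- `Σ {λ log p : p ∣ n} = λ log n` for squarefree `n`. -/
theorem logMultiset_sum_of_squarefree (lam : ℝ) {n : ℕ} (hn : Squarefree n) :
    (logMultiset lam n).sum = lam * Real.log n := by
  unfold logMultiset
  rw [← Finset.sum_eq_multiset_sum, ← Finset.mul_sum, ← Real.log_prod, ← Nat.cast_prod,
    Nat.prod_primeFactors_of_squarefree hn]
  intro p hp
  exact_mod_cast (Nat.pos_of_mem_primeFactors hp).ne'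

/-- `{λ log p : p ∣ ab} = {λ log p : p ∣ a} ⊎ {λ log p : p ∣ b}` for coprime `a, b`. -/
theorem logMultiset_mul_of_coprime (lam : ℝ) {a b : ℕ} (hab : a.Coprime b) :
    logMultiset lam (a * b) = logMultiset lam a + logMultiset lam b := by
  unfold logMultiset
  rw [Nat.Coprime.primeFactors_mul hab, ← Finset.disjUnion_eq_union _ _ hab.disjoint_primeFactors,
    Finset.disjUnion_val, Multiset.map_add]

/-- `{λ log p : p ∣ r}` (`λ > 0`) is a sub-multiset of any multiset containing each of its
elements (it has no repetitions). -/
theorem logMultiset_le_of_forall_mem {lam : ℝ} (hlam : 0 < lam) {r : ℕ} {V : Multiset ℝ}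
    (h : ∀ p ∈ r.primeFactors, lam * Real.log p ∈ V) : logMultiset lam r ≤ V := by
  have hnd : (logMultiset lam r).Nodup := by
    unfold logMultiset
    refine Multiset.Nodup.map_on (fun p hp p' hp' hpp' => ?_) r.primeFactors.nodup
    have hp0 : (0 : ℝ) < p := by exact_mod_cast Nat.pos_of_mem_primeFactors hp
    have hp0' : (0 : ℝ) < p' := by exact_mod_cast Nat.pos_of_mem_primeFactors hp'
    have h1 : Real.log p = Real.log p' := mul_left_cancel₀ hlam.ne' hpp'
    exact_mod_cast Real.log_injOn_pos (Set.mem_Ioi.2 hp0) (Set.mem_Ioi.2 hp0') h1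
  rw [Multiset.le_iff_subset hnd]
  intro v hv
  obtain ⟨p, hp, rfl⟩ := mem_logMultiset.1 hv
  exact h p hp

/-- For squarefree `e_j` (`j ∈ s`), the multiset `⨄_{j ∈ s} {λ log p : p ∣ e_j}` of the logarithms of
all their prime factors (a prime dividing two of them listed twice) is a refinement of
`{λ log e_j : j ∈ s}` (proof of Lemma 4.5: "`V₁` … is a refinement of `T ⊎ T'`"). -/
theorem isRefinement_logBlocks {ι : Type*} (s : Finset ι) {lam : ℝ} (hlam : 0 ≤ lam) {e : ι → ℕ}
    (he : ∀ j ∈ s, Squarefree (e j)) :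
    IsRefinement (s.val.map fun j => logMultiset lam (e j)).join
      (s.val.map fun j => lam * Real.log (e j)) := by
  refine ⟨s.val.map fun j => logMultiset lam (e j), fun W hW => ?_, ?_, rfl⟩
  · obtain ⟨j, -, rfl⟩ := Multiset.mem_map.1 hW
    exact logMultiset_nonneg hlam
  · rw [Multiset.map_map]
    refine Multiset.map_congr rfl fun j hj => ?_
    simpa using logMultiset_sum_of_squarefree lam (he j (Finset.mem_def.2 hj))

/-- A prime factor of `∏_{j ∈ s} e_j` contributes its logarithm to `⨄_{j ∈ s} {λ log p : p ∣ e_j}`. -/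
theorem mem_join_logBlocks {ι : Type*} (s : Finset ι) (lam : ℝ) {e : ι → ℕ} {p : ℕ}
    (hp : p.Prime) (he0 : ∀ j ∈ s, e j ≠ 0) (hdvd : p ∣ ∏ j ∈ s, e j) :
    lam * Real.log p ∈ (s.val.map fun j => logMultiset lam (e j)).join := by
  obtain ⟨j, hj, hpj⟩ := hp.prime.exists_mem_finset_dvd hdvd
  rw [Multiset.mem_join]
  refine ⟨logMultiset lam (e j), Multiset.mem_map.2 ⟨j, hj, rfl⟩, ?_⟩
  exact mem_logMultiset.2 ⟨p, Nat.mem_primeFactors.2 ⟨hp, hpj, he0 j hj⟩, rfl⟩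

/-! ### §3. The heart of Lemma 4.5 at the level of multisets -/

/-- **The multiset core of the proof of Lemma 4.5** (`lem:H2`).  Let `PC_{ϱ₀}(T, T')` hold
(Definition 4.1), `ϱ₀ ≥ 0`, and fix a grade `g`.  Let `V₁` be a refinement of `T ⊎ T'`, `V₂` a
sub-multiset of `V₁` of mass `Σ V₂ ≥ L_g − ϱ₀/2` (so the deleted mass is `D ≤ Σ T + Σ T' − L_g + ϱ₀/2`),
and `E` a multiset of non-negative reals `≤ c_g`.  Then `V₂ ⊎ E` satisfies `𝒞_{i_g}(c_g; 0)`.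
Proof as printed: `Σ T + Σ T' ≥ L_g − ϱ₀` activates the grade-`g` clause of `PC_{ϱ₀}`; by `B = Σ − U`
(`CondC.of_Usum_le`) `T ⊎ T'` satisfies `𝒞_{i_g}(c_g; ϱ₀ + Σ T + Σ T' − L_g)`; Lemma 3.2(a)
(`CondC.of_isRefinement`) transports this to `V₁`, Lemma 3.2(b) (`CondC.of_delete`) to `V₂` with
`β = ϱ₀ − L_g + Σ V₂ ≥ ϱ₀/2 ≥ 0`, and Lemma 3.2(c) (`CondC.add_small`) adds `E`. -/
theorem condC_of_pc {n : ℕ} (D : GradeData n) {ϱ₀ : ℝ} (hϱ₀ : 0 ≤ ϱ₀) {T T' : Multiset ℝ}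
    (hPC : PC D ϱ₀ T T') (g : Fin n) {V₁ V₂ E : Multiset ℝ}
    (hV₁ : IsRefinement V₁ (T + T')) (hV₂ : V₂ ≤ V₁) (hmass : D.L g - ϱ₀ / 2 ≤ V₂.sum)
    (hE0 : ∀ x ∈ E, 0 ≤ x) (hEc : ∀ x ∈ E, x ≤ D.c g) :
    CondC (D.i g) (D.c g) 0 (V₂ + E) := by
  obtain ⟨Dm, hDm⟩ := Multiset.le_iff_exists_add.1 hV₂
  have h0 : ∀ x ∈ V₁, 0 ≤ x := hV₁.nonneg
  have hD0 : ∀ x ∈ Dm, 0 ≤ x := fun x hx =>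
    h0 x (by rw [hDm]; exact Multiset.mem_add.2 (Or.inr hx))
  have hsum : V₁.sum = (T + T').sum := hV₁.sum_eq
  have hsum' : V₁.sum = V₂.sum + Dm.sum := by rw [hDm, Multiset.sum_add]
  have hDs : 0 ≤ Dm.sum := Multiset.sum_nonneg hD0
  have hTT : (T + T').sum = T.sum + T'.sum := Multiset.sum_add _ _
  have hact : D.L g - ϱ₀ ≤ T.sum + T'.sum := by linarith
  have h1 : CondC (D.i g) (D.c g) (ϱ₀ + (T + T').sum - D.L g) (T + T') :=
    CondC.of_Usum_le fun v hv hcv => by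
      rw [Usum_add]
      exact hPC g hact v hv hcv
  have h2 : CondC (D.i g) (D.c g) (ϱ₀ + (T + T').sum - D.L g) (V₂ + Dm) := by
    rw [← hDm]
    exact h1.of_isRefinement hV₁
  have h3 := h2.of_delete hD0
  have h4 : CondC (D.i g) (D.c g) 0 V₂ := h3.mono (by linarith)
  exact h4.add_small hE0 hEc

/-- **Lemma 4.5, arithmetic form.**  Let `PC_{ϱ₀}(T, T')` hold, `ϱ₀ ≥ 0`, `λ > 0`, `y ≥ 1` with
`c_g = λ log y`, and let `q = W r` be squarefree with: every prime of `r` contributes `λ log p` to a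
fixed refinement `V₁` of `T ⊎ T'`; every prime `p ∣ W` has `λ log p ≤ c_g`; `λ log W ≤ ϱ₀/2`; and
`λ log q > L_g` (eq. (4.4) `eq:qLg`).  Then `q ∈ 𝒟^{(i_g)}(y)` — by `condC_of_pc` with
`V₂ = {λ log p : p ∣ r}`, `E = {λ log p : p ∣ W}`, and Proposition 3.3 (`denselyDivisible_of_condC`). -/
theorem denselyDivisible_of_pc {n : ℕ} (D : GradeData n) {ϱ₀ : ℝ} (hϱ₀ : 0 ≤ ϱ₀) {T T' : Multiset ℝ}
    (hPC : PC D ϱ₀ T T') (g : Fin n) {lam y : ℝ} (hlam : 0 < lam) (hy : 1 ≤ y)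
    (hc : D.c g = lam * Real.log y) {V₁ : Multiset ℝ} (hV₁ : IsRefinement V₁ (T + T'))
    {q W r : ℕ} (hq : Squarefree q) (hqWr : q = W * r)
    (hr : ∀ p ∈ r.primeFactors, lam * Real.log p ∈ V₁)
    (hW : ∀ p ∈ W.primeFactors, lam * Real.log p ≤ D.c g) (hWm : lam * Real.log W ≤ ϱ₀ / 2)
    (hqL : D.L g < lam * Real.log q) : DenselyDivisible y (D.i g) q := by
  subst hqWr
  have hq0 : W * r ≠ 0 := Squarefree.ne_zero hq
  have hW0 : W ≠ 0 := left_ne_zero_of_mul hq0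
  have hr0 : r ≠ 0 := right_ne_zero_of_mul hq0
  have hcop : W.Coprime r := Nat.coprime_of_squarefree_mul hq
  have hrsq : Squarefree r := hq.squarefree_of_dvd (dvd_mul_left r W)
  apply denselyDivisible_of_condC hy hlam (D.i g) hq
  rw [← hc, logMultiset_mul_of_coprime lam hcop, add_comm]
  refine condC_of_pc D hϱ₀ hPC g hV₁ (logMultiset_le_of_forall_mem hlam hr) ?_
    (logMultiset_nonneg hlam.le) ?_
  · rw [logMultiset_sum_of_squarefree lam hrsq]
    have h1 : Real.log ((W * r : ℕ) : ℝ) = Real.log W + Real.log r := by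
      rw [Nat.cast_mul, Real.log_mul (by exact_mod_cast hW0) (by exact_mod_cast hr0)]
    rw [h1, mul_add] at hqL
    linarith
  · intro v hv
    obtain ⟨p, hp, rfl⟩ := mem_logMultiset.1 hv
    exact hW p hp

/-! ### §4. Lemma 4.5: corners of an admissible pair of regions -/

/-- **Lemma 4.5 (`lem:H2`), part (i) of Definition 4.2.**  Let `(Ω, Ω')` be `ϱ₀`-admissible for the
grade data `D`, `0 ≤ ϱ ≤ ϱ₀/2`, `1 ≤ m ≤ k`, and let `a ∈ Ω^{+ϱ}`, `a' ∈ Ω'^{+ϱ}` be corners.  Let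
`d_j` (`j ≠ m`) and `d'_j` be divisors of a squarefree `q = W r` with `λ log d_j ∈ [a_j, a_j + ϱ]`,
`λ log d'_j ∈ [a'_j, a'_j + ϱ]` (this is what `∏_{j ≠ m} f_j(λ log d_j) g_j(λ log d'_j) ≠ 0` says for
pieces `f_j`, `g_j` supported in those windows) and `r ∣ ∏_{j ≠ m} d_j · ∏_j d'_j` (in the paper
`r = q/W = ∏_{j ≠ m} [d_j, d'_j]`).  Fix a grade `g` with `c_g = λ log y`, `y ≥ 1`, and assume the two
"`x` large" facts `λ log p ≤ c_g` for `p ∣ W` and `λ log W ≤ ϱ₀/2`.  If `λ log q > L_g` (eq. (4.4)),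
then `q ∈ 𝒟^{(i_g)}(y)`.  (The paper's `λ` is `2/(θ log x)`; see `hypothesisH2_of_admissible` for the
instance with `y = x^{δ_g}` and the ranges of (H2).) -/
theorem denselyDivisible_of_admissible {n k k' : ℕ} (D : GradeData n) {ϱ₀ ϱ : ℝ}
    {Ω : Set (Fin k → ℝ)} {Ω' : Set (Fin k' → ℝ)} (hadm : Admissible D ϱ₀ Ω Ω')
    (hϱ : 0 ≤ ϱ) (hϱ2 : 2 * ϱ ≤ ϱ₀) (m : Fin k) {a : Fin k → ℝ} {a' : Fin k' → ℝ}
    (ha : a ∈ thicken Ω ϱ) (ha' : a' ∈ thicken Ω' ϱ)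
    {lam y : ℝ} (hlam : 0 < lam) (hy : 1 ≤ y) (g : Fin n) (hc : D.c g = lam * Real.log y)
    {d : Fin k → ℕ} {d' : Fin k' → ℕ}
    (hd : ∀ j, j ≠ m → a j ≤ lam * Real.log (d j) ∧ lam * Real.log (d j) ≤ a j + ϱ)
    (hd' : ∀ j, a' j ≤ lam * Real.log (d' j) ∧ lam * Real.log (d' j) ≤ a' j + ϱ)
    {q W r : ℕ} (hq : Squarefree q) (hqWr : q = W * r)
    (hr : r ∣ (∏ j ∈ univ.erase m, d j) * ∏ j, d' j)
    (hdq : ∀ j, j ≠ m → d j ∣ q) (hd'q : ∀ j, d' j ∣ q)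
    (hW : ∀ p ∈ W.primeFactors, lam * Real.log p ≤ D.c g) (hWm : lam * Real.log W ≤ ϱ₀ / 2)
    (hqL : D.L g < lam * Real.log q) :
    DenselyDivisible y (D.i g) q := by
  classical
  have hϱ₀ : 0 ≤ ϱ₀ := by linarith
  obtain ⟨ha0, t, htΩ, hat⟩ := ha
  obtain ⟨ha0', t', ht'Ω, hat'⟩ := ha'
  -- the points `t̃ ∈ Ω^{+ϱ₀}` (with `t̃_m := a_m`) and `t̃' ∈ Ω'^{+ϱ₀}`
  let tt : Fin k → ℝ := Function.update (fun j => lam * Real.log (d j)) m (a m)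
  let tt' : Fin k' → ℝ := fun j => lam * Real.log (d' j)
  have htt_m : tt m = a m := by simp [tt]
  have htt_j : ∀ j, j ≠ m → tt j = lam * Real.log (d j) := fun j hj => by simp [tt, hj]
  have htt_mem : tt ∈ thicken Ω ϱ₀ := by
    refine ⟨fun j => ?_, t, htΩ, fun j => ?_⟩
    · by_cases hj : j = m
      · rw [hj, htt_m]; exact ha0 _
      · rw [htt_j j hj]; exact le_trans (ha0 j) (hd j hj).1
    · by_cases hj : j = m
      · rw [hj, htt_m]; exact le_trans (hat _) (by linarith)
      · rw [htt_j j hj]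
        have h1 := hd j hj
        have h2 := (abs_le.1 (hat j))
        rw [abs_le]; constructor <;> linarith [h1.1, h1.2, h2.1, h2.2]
  have htt'_mem : tt' ∈ thicken Ω' ϱ₀ := by
    refine ⟨fun j => le_trans (ha0' j) (hd' j).1, t', ht'Ω, fun j => ?_⟩
    have h1 := hd' j
    have h2 := abs_le.1 (hat' j)
    show |lam * Real.log (d' j) - t' j| ≤ ϱ₀
    rw [abs_le]; constructor <;> linarith [h1.1, h1.2, h2.1, h2.2]
  have hPC : PC D ϱ₀ (msetDrop tt m) (mset tt') := hadm.1 tt htt_mem tt' htt'_mem m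
  -- `T = {λ log d_j : j ≠ m}`, `T' = {λ log d'_j}`
  have hT : msetDrop tt m = (univ.erase m).val.map fun j => lam * Real.log (d j) :=
    Multiset.map_congr rfl fun j hj => htt_j j (Finset.ne_of_mem_erase (Finset.mem_def.2 hj))
  have hT' : mset tt' = (univ : Finset (Fin k')).val.map fun j => lam * Real.log (d' j) := rfl
  have hdsq : ∀ j ∈ univ.erase m, Squarefree (d j) := fun j hj =>
    hq.squarefree_of_dvd (hdq j (Finset.ne_of_mem_erase hj))
  have hd'sq : ∀ j ∈ (univ : Finset (Fin k')), Squarefree (d' j) := fun j _ =>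
    hq.squarefree_of_dvd (hd'q j)
  have hV₁ : IsRefinement (((univ.erase m).val.map fun j => logMultiset lam (d j)).join +
      ((univ : Finset (Fin k')).val.map fun j => logMultiset lam (d' j)).join)
      (msetDrop tt m + mset tt') := by
    rw [hT, hT']
    exact (isRefinement_logBlocks _ hlam.le hdsq).add (isRefinement_logBlocks _ hlam.le hd'sq)
  refine denselyDivisible_of_pc D hϱ₀ hPC g hlam hy hc hV₁ hq hqWr (fun p hp => ?_) hW hWm hqL
  have hpp := Nat.prime_of_mem_primeFactors hp
  have hpdvd : p ∣ (∏ j ∈ univ.erase m, d j) * ∏ j, d' j :=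
    dvd_trans (Nat.dvd_of_mem_primeFactors hp) hr
  rcases (Nat.Prime.dvd_mul hpp).1 hpdvd with h | h
  · exact Multiset.mem_add.2 (Or.inl
      (mem_join_logBlocks _ lam hpp (fun j hj => (hdsq j hj).ne_zero) h))
  · exact Multiset.mem_add.2 (Or.inr
      (mem_join_logBlocks _ lam hpp (fun j hj => (hd'sq j hj).ne_zero) h))

/-- **Lemma 4.5 (`lem:H2`), part (ii) of Definition 4.2** ("The same holds for `F_j = 𝐠_j`,
`G_j = 𝐠*_j` when `(g*_j)` is a second family of the same kind attached to a corner
`a'' ∈ Ω'^{+ϱ}`"): both families of divisors sit at corners of `Ω'^{+ϱ}`. -/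
theorem denselyDivisible_of_admissible' {n k k' : ℕ} (D : GradeData n) {ϱ₀ ϱ : ℝ}
    {Ω : Set (Fin k → ℝ)} {Ω' : Set (Fin k' → ℝ)} (hadm : Admissible D ϱ₀ Ω Ω')
    (hϱ : 0 ≤ ϱ) (hϱ2 : 2 * ϱ ≤ ϱ₀) {a' a'' : Fin k' → ℝ}
    (ha' : a' ∈ thicken Ω' ϱ) (ha'' : a'' ∈ thicken Ω' ϱ)
    {lam y : ℝ} (hlam : 0 < lam) (hy : 1 ≤ y) (g : Fin n) (hc : D.c g = lam * Real.log y)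
    {d' d'' : Fin k' → ℕ}
    (hd' : ∀ j, a' j ≤ lam * Real.log (d' j) ∧ lam * Real.log (d' j) ≤ a' j + ϱ)
    (hd'' : ∀ j, a'' j ≤ lam * Real.log (d'' j) ∧ lam * Real.log (d'' j) ≤ a'' j + ϱ)
    {q W r : ℕ} (hq : Squarefree q) (hqWr : q = W * r)
    (hr : r ∣ (∏ j, d' j) * ∏ j, d'' j) (hd'q : ∀ j, d' j ∣ q) (hd''q : ∀ j, d'' j ∣ q)
    (hW : ∀ p ∈ W.primeFactors, lam * Real.log p ≤ D.c g) (hWm : lam * Real.log W ≤ ϱ₀ / 2)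
    (hqL : D.L g < lam * Real.log q) :
    DenselyDivisible y (D.i g) q := by
  classical
  have hϱ₀ : 0 ≤ ϱ₀ := by linarith
  have corner : ∀ {b : Fin k' → ℝ} {e : Fin k' → ℕ}, b ∈ thicken Ω' ϱ →
      (∀ j, b j ≤ lam * Real.log (e j) ∧ lam * Real.log (e j) ≤ b j + ϱ) →
      (fun j => lam * Real.log (e j)) ∈ thicken Ω' ϱ₀ := by
    intro b e hb he
    obtain ⟨hb0, t', ht'Ω, hbt⟩ := hb
    refine ⟨fun j => le_trans (hb0 j) (he j).1, t', ht'Ω, fun j => ?_⟩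
    have h1 := he j
    have h2 := abs_le.1 (hbt j)
    show |lam * Real.log (e j) - t' j| ≤ ϱ₀
    rw [abs_le]; constructor <;> linarith [h1.1, h1.2, h2.1, h2.2]
  have hPC : PC D ϱ₀ (mset fun j => lam * Real.log (d' j)) (mset fun j => lam * Real.log (d'' j)) :=
    hadm.2 _ (corner ha' hd') _ (corner ha'' hd'')
  have hd'sq : ∀ j ∈ (univ : Finset (Fin k')), Squarefree (d' j) := fun j _ =>
    hq.squarefree_of_dvd (hd'q j)
  have hd''sq : ∀ j ∈ (univ : Finset (Fin k')), Squarefree (d'' j) := fun j _ =>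
    hq.squarefree_of_dvd (hd''q j)
  have hV₁ : IsRefinement ((((univ : Finset (Fin k'))).val.map fun j => logMultiset lam (d' j)).join +
      ((univ : Finset (Fin k')).val.map fun j => logMultiset lam (d'' j)).join)
      ((mset fun j => lam * Real.log (d' j)) + mset fun j => lam * Real.log (d'' j)) :=
    (isRefinement_logBlocks _ hlam.le hd'sq).add (isRefinement_logBlocks _ hlam.le hd''sq)
  refine denselyDivisible_of_pc D hϱ₀ hPC g hlam hy hc hV₁ hq hqWr (fun p hp => ?_) hW hWm hqL
  have hpp := Nat.prime_of_mem_primeFactors hp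
  have hpdvd : p ∣ (∏ j, d' j) * ∏ j, d'' j := dvd_trans (Nat.dvd_of_mem_primeFactors hp) hr
  rcases (Nat.Prime.dvd_mul hpp).1 hpdvd with h | h
  · exact Multiset.mem_add.2 (Or.inl
      (mem_join_logBlocks _ lam hpp (fun j hj => (hd'sq j hj).ne_zero) h))
  · exact Multiset.mem_add.2 (Or.inr
      (mem_join_logBlocks _ lam hpp (fun j hj => (hd''sq j hj).ne_zero) h))

end Summit.Parity.GeneralizedHardyLittlewood.Theorems.Dhl42
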